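import Summits.BirchSwinnertonDyer.BirchSwinnertonDyer.Theorems.GenusKolyvaginAtTwoGenusPrimitiveSupplyAtTwoPrimeHeegnerTwinUnramified
import Literature.NumberTheory.EllipticCurves.CasselsTateGeneralCaseKernel
import Literature.NumberTheory.EllipticCurves.SelmerFiniteProofs
import HarnessLib

/-!
# Route `GenusKolyvaginAtTwo`, crux U_T `ShaCardDvdPowAtTwoRT` (stmt-BirchSwinnertonDyer-23658), LINE 19 `rational_pair_descent` v1.1
# (LEAD gk2-p1 g19), stub PAIRCOUNT — item (RANKQ) ON THE CUT «`|d_K|` PRIME»: `#Ш(E/ℚ)[2] ≤ #Sel₂(E/ℚ) ≤ 4` UNCONDITIONALLY,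
# (the input (RANKQ) of PAIRCOUNT there)

Seat `bsd-line-gk2-p5` g29 (WIDTH-5 attach, cell `bsd-f1-sign2`), `--supports stmt-BirchSwinnertonDyer-23658` (helper; closes nothing).
THEOREMS ONLY (no definition, no named fact, no `sorry`).  BSD is NOT proved by any of this; neither is U_T, nor PAIRCOUNT.

WHY.  LINE 19 v1.1: PAIRCOUNT `#Ш(E/ℚ)[2^∞] ∣ 4^M₀` = (B2Q) `2^M₀ · Ш(E/ℚ)[2^∞] = 0` + (RANKQ) `#Ш(E/ℚ)[2] ≤ 4` + (CTQ) (this seat,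
`…RTShaFiniteAtTwoCTQ`).  On the LEAD's recommended cut R7-d «`|d_K| = ℓ` prime» (RANKQ) is ALREADY in the tree, unconditionally: the
SUPPLY lineage's Mazur–Rubin Cor. 3.4 (i) for the prime Heegner twin, `2` split OR inert, no image hypothesis
(`GenusKolyTwin.cor34i_twin_prime_heegner_unramified`, gk2-p5 g12): `Sel₂(E)` strict at `ℓ` ⟹ `#Sel₂(Wd) = 2·#Sel₂(E)`, not strict ⟹
`#Sel₂(E) = 2·#Sel₂(Wd)`.  With the 2-Selmer-minimal twin (`#Sel₂(Wd) = 2`) this gives `#Sel₂(E) ∈ {1, 4}`, and `Ш(E/ℚ)[2]` is a quotient of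
`Sel₂(E)` (Kummer sequence).  No `w(E) = 1`, no Q2, no `ρ̄`-hypothesis is needed for (RANKQ) itself.

* §1 `natCard_sha_torsionBy_le_natCard_selmerGroup` — ANY elliptic curve over ANY number field, any `m ≥ 1`: `#Ш(E/F)[m] ≤ #Sel_m(E/F)`
  (`exists_selmer_lift`: every class of `Ш[m]` has a Selmer lift; `Sel_m` is finite).
* §2 `natCard_selmerGroup_two_le_four_of_minimalTwin_prime` — `W/ℚ` globally minimal, `Δ < 0`, `K` imaginary quadratic with `d_K = −ℓ`
  (`ℓ` prime), Heegner for `N_W`, `Wd ≅ W^(d_K)` with `#Sel₂(Wd) = 2` ⟹ **`#Sel₂(W) ≤ 4`** (indeed `∈ {1, 4}`: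
  `natCard_selmerGroup_two_eq_one_or_eq_four_of_minimalTwin_prime`).
* §3 **`natCard_sha_two_torsion_le_four_of_minimalTwin_prime`** — (RANKQ) on the cut: **`#Ш(W/ℚ)[2] ≤ 4`**, unconditionally.
(PAIRCOUNT on the cut modulo (B2Q) alone — §3 + (CTQ) — is assembled in the sequel `…RTShaFiniteAtTwoPairCountOfB2`.)

References: [MazurRubin2010] Thm. 2.7, Lemmas 2.9–2.11, Prop. 3.3, Cor. 3.4 (i); [Kramer1981] Thm. 1, Props. 3, 7; [Mazur1972] Cor. 4.4;
[SilvermanAEC2009] Thm. X.4.2; [Kolyvagin1989Izv] Thm. B₂; [McCallumLMS1991] §5 Cor. 5.6.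
-/

set_option autoImplicit false
-- the Theorems namespace of this sub repeats the summit name by design (D-0017 nested layout)
set_option linter.dupNamespace false

noncomputable section

open scoped Classical
open scoped AddSubgroup

namespace Summit.BirchSwinnertonDyer.BirchSwinnertonDyer.Theorems.GenusExact.PlusDescent

open WeierstrassCurve NumberField IsDedekindDomain Field Literature.NumberTheory.EllipticCurves
  Literature.NumberTheory.GaloisRepresentations Literature.NumberTheory.EllipticCurves.ModularForms AddSubgroup
open Summit.BirchSwinnertonDyer.BirchSwinnertonDyer.Theses.GenusKolyvaginAtTwo (KolyvaginRelationAtTwo)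
open Summit.BirchSwinnertonDyer.Rank1Residual

universe u

/-! ## §1 `#Ш(E/F)[m] ≤ #Sel_m(E/F)` -/

/-- **`#Ш(E/F)[m] ≤ #Sel_m(E/F)`** for every elliptic curve over every number field and every `m ≥ 1`: each class of `Ш(E/F)[m]` has a lift in
the `m`-Selmer group (Kummer sequence, `exists_selmer_lift`), and choosing one lift per class is injective; `Sel_m(E/F)` is finite
(AEC X.4.2 (b)). [cite: SilvermanAEC2009, Thm. X.4.2 (a), (b)] -/
theorem natCard_sha_torsionBy_le_natCard_selmerGroup {F : Type u} [Field F] [NumberField F] (V : WeierstrassCurve F) [V.IsElliptic]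
    (m : ℕ) [NeZero m] : Nat.card ((V.sha)[(m : ℕ)]) ≤ Nat.card (selmerGroup V (m : ℤ)) := by
  have hm : (m : ℤ) ≠ 0 := Int.natCast_ne_zero.mpr (NeZero.ne m)
  haveI : Finite (selmerGroup V (m : ℤ)) := V.finite_selmerGroup_holds hm
  have hlift : ∀ x : (V.sha)[(m : ℕ)], ∃ b ∈ selmerGroup V (m : ℤ),
      torsionH1ToH1 V (m : ℤ) b = ((x : V.sha) : V.galH1) := fun x ↦ by
    refine exists_selmer_lift (W := V) (m := m) (x : V.sha).2 ?_
    have hx : m • (x : V.sha) = 0 := torsionBy.nsmul_iff.mp x.2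
    have hx' : ((m • (x : V.sha) : V.sha) : V.galH1) = 0 := by rw [hx]; rfl
    rwa [AddSubgroupClass.coe_nsmul, ← natCast_zsmul] at hx'
  choose b hb hbx using hlift
  refine Nat.card_le_card_of_injective (fun x ↦ (⟨b x, hb x⟩ : selmerGroup V (m : ℤ))) fun x y hxy ↦ ?_
  have hb' : b x = b y := congrArg Subtype.val hxy
  have h : ((x : V.sha) : V.galH1) = ((y : V.sha) : V.galH1) := by rw [← hbx x, ← hbx y, hb']
  exact Subtype.ext (Subtype.ext h)

/-! ## §2 `#Sel₂(W) ≤ 4` for a curve with a 2-Selmer-minimal prime Heegner twin -/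

/-- **`#Sel₂(W) ∈ {1, 4}` when the prime Heegner twin is 2-Selmer-minimal.**  `W/ℚ` globally minimal elliptic with `Δ_W < 0`, `K` imaginary
quadratic with `d_K = −ℓ` (`ℓ` prime) and the Heegner hypothesis for `N_W`, `Wd` an elliptic model of `W^(d_K)` with `#Sel₂(Wd) = 2`: then
`#Sel₂(W) = 1` (if `Sel₂(W)` is strict at `ℓ`: `#Sel₂(Wd) = 2·#Sel₂(W)`) or `#Sel₂(W) = 4` (if not: `#Sel₂(W) = 2·#Sel₂(Wd)`) — Mazur–Rubin
Cor. 3.4 (i) for the prime Heegner twin, `2` split or inert, UNCONDITIONAL (`GenusKolyTwin.cor34i_twin_prime_heegner_unramified`).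
[cite: MazurRubin2010, Prop. 3.3, Cor. 3.4 (i)] [cite: Kramer1981, Thm. 1, Prop. 3] [cite: Mazur1972, Cor. 4.4] -/
theorem natCard_selmerGroup_two_eq_one_or_eq_four_of_minimalTwin_prime (W : WeierstrassCurve ℚ) [W.IsElliptic] [W.IsGloballyMinimal]
    {K : Type} [Field K] [NumberField K] (hΔ : W.Δ < 0) (hK : IsImaginaryQuadratic K) (hodd : Odd (NumberField.discr K))
    (hH : SatisfiesHeegnerHypothesis (W.conductorNorm ℤ) K) {ℓ : ℕ} [Fact ℓ.Prime] (hd : NumberField.discr K = -(ℓ : ℤ))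
    (Wd : WeierstrassCurve ℚ) [Wd.IsElliptic] (hWd : ∃ C : VariableChange ℚ, C • W.quadraticTwist (NumberField.discr K : ℚ) = Wd)
    (hSel : Nat.card (Wd.selmerGroup 2) = 2) :
    Nat.card (W.selmerGroup 2) = 1 ∨ Nat.card (W.selmerGroup 2) = 4 := by
  obtain ⟨hup, hdown⟩ := GenusKolyTwin.cor34i_twin_prime_heegner_unramified W hΔ hK hodd hH hd Wd hWd
  by_cases hs : W.selmerGroup 2 ≤ MazurRubin2010.strictLocalKer W ℚ_[ℓ] 2
  · have h := hup hs
    left; omega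
  · have h := hdown hs
    right; omega

/-- **`#Sel₂(W) ≤ 4`** in the situation of `natCard_selmerGroup_two_eq_one_or_eq_four_of_minimalTwin_prime`.
[cite: MazurRubin2010, Prop. 3.3, Cor. 3.4 (i)] -/
theorem natCard_selmerGroup_two_le_four_of_minimalTwin_prime (W : WeierstrassCurve ℚ) [W.IsElliptic] [W.IsGloballyMinimal]
    {K : Type} [Field K] [NumberField K] (hΔ : W.Δ < 0) (hK : IsImaginaryQuadratic K) (hodd : Odd (NumberField.discr K))
    (hH : SatisfiesHeegnerHypothesis (W.conductorNorm ℤ) K) {ℓ : ℕ} [Fact ℓ.Prime] (hd : NumberField.discr K = -(ℓ : ℤ))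
    (Wd : WeierstrassCurve ℚ) [Wd.IsElliptic] (hWd : ∃ C : VariableChange ℚ, C • W.quadraticTwist (NumberField.discr K : ℚ) = Wd)
    (hSel : Nat.card (Wd.selmerGroup 2) = 2) :
    Nat.card (W.selmerGroup 2) ≤ 4 := by
  rcases natCard_selmerGroup_two_eq_one_or_eq_four_of_minimalTwin_prime W hΔ hK hodd hH hd Wd hWd hSel with h | h <;> omega

/-! ## §3 (RANKQ) on the cut «`|d_K|` prime»: `#Ш(W/ℚ)[2] ≤ 4` -/

/-- **(RANKQ) on the cut, UNCONDITIONAL: `#Ш(W/ℚ)[2] ≤ 4`** for `W/ℚ` globally minimal elliptic with `Δ_W < 0`, `K` imaginary quadratic with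
`d_K = −ℓ` (`ℓ` prime), Heegner for `N_W`, and a 2-Selmer-minimal model `Wd ≅ W^(d_K)` (`#Sel₂(Wd) = 2`): `Ш(W/ℚ)[2]` is a quotient of
`Sel₂(W)` (§1) and `#Sel₂(W) ≤ 4` (§2). [cite: MazurRubin2010, Cor. 3.4 (i)] [cite: SilvermanAEC2009, Thm. X.4.2] -/
theorem natCard_sha_two_torsion_le_four_of_minimalTwin_prime (W : WeierstrassCurve ℚ) [W.IsElliptic] [W.IsGloballyMinimal]
    {K : Type} [Field K] [NumberField K] (hΔ : W.Δ < 0) (hK : IsImaginaryQuadratic K) (hodd : Odd (NumberField.discr K))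
    (hH : SatisfiesHeegnerHypothesis (W.conductorNorm ℤ) K) {ℓ : ℕ} [Fact ℓ.Prime] (hd : NumberField.discr K = -(ℓ : ℤ))
    (Wd : WeierstrassCurve ℚ) [Wd.IsElliptic] (hWd : ∃ C : VariableChange ℚ, C • W.quadraticTwist (NumberField.discr K : ℚ) = Wd)
    (hSel : Nat.card (Wd.selmerGroup 2) = 2) :
    Nat.card (AddSubgroup.torsionBy W.sha ((2 : ℕ) : ℤ)) ≤ 4 := by
  have h1 := natCard_sha_torsionBy_le_natCard_selmerGroup W 2
  have h2 := natCard_selmerGroup_two_le_four_of_minimalTwin_prime W hΔ hK hodd hH hd Wd hWd hSel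
  have h12 : Nat.card (selmerGroup W ((2 : ℕ) : ℤ)) = Nat.card (W.selmerGroup 2) := rfl
  rw [h12] at h1
  exact h1.trans h2

end Summit.BirchSwinnertonDyer.BirchSwinnertonDyer.Theorems.GenusExact.PlusDescent

end
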